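import Summits.QuantumFields.BalabanUV.T4Continuum.Support.NE9CurChartUniformBall
import Literature.MathematicalPhysics.QuantumFieldTheory.Balaban1983to89.B9Eq3126H1BoundGaugeOrbit

/-!
# NE9CurChartGaugeOrbit — THE CHART OF THE CURVE SPECIES `cur V` EXISTS, ON THE SAME BALL, AT EVERY BACKGROUND `V = U^u` GAUGE-EQUIVALENT TO A
# SMALL FIELD `U` OF A FIXED LATTICE: `Support/NE9CurChartUniformBall.cur_chart_exists_of_small_field_uniform` (owner gen 81) carried from the
# small-field ball to its gauge orbit by [Balaban1985BackgroundPropagators] (3.34) typed on the chain's carriers (NE9 leaf-03 gen 60: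
# `B9Eq328GaugeAction` … `B9Eq3126H1BoundGaugeOrbit`); cell `pub-balaban`, T4-DAG §2 node U3 / §6 NE9, WALL-NE9-P1 §3 (ii); Summits-side NEW leaf
# under the INTERFACE REQUEST NE9 of this generation (ruling e34b3e0c (0): «no new leaves unless a CRUX prover requests a specific NAMED interface» —
# requested: `NE9CurChartGaugeOrbit.cur_chart_exists_of_gaugeOrbit_small_field`; a separate file because the host leaf is the owner lineage's and near
# the 400-line rule), nothing printed asserted

HONEST FRAMING (T4-DAG PAGE 1).  Rung (B)+1 of the FINITE-VOLUME T⁴ programme — NOT infinite volume, NOT a mass gap, NOT the Clay problem.  NE9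
(`T4OutputRate.NE9` ∧ `FadingMemory`) is a cell NEW ESTIMATE, NOT PRINTED in [I] = [Balaban1987RG1] (CMP **109**), [II] = [Balaban1988RG2Cluster]
(CMP **116**), and NOT PROVED here («NE9 ⇐ the named binders»; spine PROVED 0∕9).  HONEST DEPENDENCY (cell line, verbatim): continuum YM on T⁴ ⇐
BetaPertH ∧ nine spine estimates (0/9 proved); BetaPertH ⇐ (D1) ∧ (D4) ∧ CAP+tail; G-an2-4 gates asym, D1 and NE2/3/4.  The `cur U` OBJECT is ONE
item of the MODEL O-NE9-1 (species (a) data); the END's `act` / `ker` halves and NEEDS-COORDINATOR #5 are untouched.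

WHAT THIS FILE PROVES (TWO theorems — one statement in the host leaf's two quantifier orders — + v1.1's two small-bond faces; 0 def, 0 sorry, axioms standard).  **`cur_chart_exists_of_gaugeOrbit_small_field`**: there are `ε₃ > 0` and radii
`ε₄, ε_C`, `R_b, R′ > 0` (the finite-lattice numbers of the host leaf: functions of `L, m, η, c₀, c₁, a`, the level weights, `M_φ, M_φ′, C_τ` and the
(L3)-slot constants `(C₄, a₃)`) such that for EVERY background `U` on the torus `T_{L·m}` with E162's displayed data, `‖U(b) − 1‖ ≤ ε ≤ ε₃` and
mutually adjoint transporters (`hRS`), EVERY gauge function `g` with `g(x) ∈ U1` unitary, `τ`-central and fibrewise isometric (the three displayed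
readings of print's `U(N)`/`tr`), ANY regularity witnesses of `V := U^g` (block-contour letters `hU1′ hreg′` — SUPPLIED in general by
`B9Eq333ProjectionCovariance.hU1_gaugeU/hreg_gaugeU`), and every `W` with `QuadAnalytic W C₄ a₃` analytic on its ball: the displayed positivity `hpos′`
([Balaban1985BackgroundPropagators] Thm 3.11 for the assembled `Δ_a(U^g)`) HOLDS and lit-balaban's chart (174)∘(47) of `cur (U^g)` —
`chartHB 𝔊(U^g) 0 W 0 (A′ ↦ A′ + solA H₁(U^g) 0 C(U^g) 0 ε_C A′) ε₄ H₁(U^g)` in the (115)-currency AT `∇_{U^g}` — is Fréchet-differentiable on `ball 0 R_b`,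
maps it into `ball 0 R′` and fixes `0` (and **`cur_chart_exists_of_gaugeOrbit_small_field'`**: the same with `∃ ε₃` before
`∀ C₄ a₃`, the host's v1.1 order): the binders (Ψ1)–(Ψ3) of the `cur` species ON ONE BALL FOR THE WHOLE GAUGE ORBIT OF THE SMALL-FIELD FAMILY —
print's regularity class (3.35) *«there exists a gauge transformation u on □ such that U^u = e^{iηA}, |A| < …»* on the one-cube torus, in place of the
small-field ball.  MECHANISM: the host leaf's proof uses the background ONLY through (i) `hpos` — transferred along the orbit by
`B9Eq334LaplaceACovariance.hpos_gaugeU` ((3.34) `Δ_a(U^u)R(u) = R(u)Δ_a(U)` with `R(u)` unitary); (ii) the operator norms `‖H₁(U)‖`, `‖𝔊(U)‖` in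
`NegSize → Space115 … (∇_U)` — GAUGE-INVARIANT functions of `U` (`B11Eq117GaugeNormInvariance`: the (115)-carrier is gauge ISOMETRIC,
`B11Eq115GaugeIsometry.gauge115Isometry`, and `H₁`, `𝔊` are conjugated), so (K)'s bounds hold at `U^g` (`B9Eq3126H1BoundGaugeOrbit`); (iii) the letter
`C(U)`'s constants, U-free (`quadAnalytic_Cc` at `U^g` with its own regularity witnesses); (iv) `Q(U^g)` onto (`QtorusW_surjective` at `U^g`); the
scalar letters of the two regimes are the host leaf's (`B11Eq118RegimeScalars.exists_twoRegimes_radii_of_bounds`); composition by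
`NE9B11ChartAnalytic.chartHB_triple_of_twoRegimes` exactly as in the host leaf.
DISGUISE TEST: composition of landed theorems; no inequality of the series proved; the radii are finite-lattice numbers — NOT print's uniformity in the
LATTICE ([Balaban1985BackgroundPropagators] Thms 3.12/3.13), NOT the (L3) `W` itself, NOT print's per-cube locality reduction of p. 416 (Thms 3.1–3.10)
— the orbit here is that of the one-cube torus; not NE9.
References (TYPES ∕ loci only): [Balaban1985Variational] (45)–(47) p. 285, Prop. 6 (117)–(121) p. 295, (172)–(175) p. 305;
[Balaban1985BackgroundPropagators] (3.26) p. 395, (3.28)–(3.35) pp. 395–396, Thm 3.4 p. 400, Thm 3.11 p. 416, (3.126) p. 420, (3.153) p. 426.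
Imports `Support/NE9CurChartUniformBall` (v1.2 — it carries `B9Eq335SmallBondsData`), `B9Eq3126H1BoundGaugeOrbit`; modifies nothing; no END re-wired.
v1.1 (APPEND-ONLY, the OWNER's pointer W-ne9p1-g82-1): `cur_chart_exists_of_gaugeOrbit_small_bonds(_unitary)` — the host's v1.2 small-bond faces on
the orbit (binders {`U1`, small bonds, `hRS`∕unitary} at `U`; the witnesses of `U^g` PRODUCED); v1's declarations byte-identical.
Value = WALL-NE9-P1 §3 (ii) «the chart of `cur U` at the constructed letters» on a U-INDEPENDENT ball, now for the GAUGE ORBIT of the small fields; NOT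
summit progress.
-/

noncomputable section

open Metric Set

namespace Summit.QuantumFields.BalabanUV.T4Continuum.NE9CurChartGaugeOrbit

open Literature.MathematicalPhysics.QuantumFieldTheory.Balaban1983to89
open B11Eq103H1Complex B11Eq115Space B11Eq174Chart
open B11Eq111FrakG (nabla115)
open B13Contraction113 (QuadAnalytic)
open B9Eq319QprimeTorus (fineP)
open B9SectCLatticeCarrier (Bond bpos)
open B4Sect5Torus (TSite)
open B7Prop1Explicit (U1 Wcx boxVec)
open B9Eq315QTorus (perCfg cornerSite QtorusW laplaceAofBackground)
open B9Eq315QTorusOnto (QtorusW_surjective)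
open B11Eq44COperatorTorus (Cc quadAnalytic_Cc analyticOnNhd_Cc)
open B9Eq328GaugeAction (gaugeU AdA AdW)
open Summit.QuantumFields.BalabanUV.T4Continuum.NE9B11ChartAnalytic (chartHB_triple_of_twoRegimes)

section GaugeOrbit

open Literature.MathematicalPhysics.QuantumFieldTheory.Balaban1983to89.B9Thm311SmallFieldClosed (laplaceAofBackground_pos_of_small_field)
open Literature.MathematicalPhysics.QuantumFieldTheory.Balaban1983to89.B9Eq3126H1BoundGaugeOrbit (exists_H1_frakG_CLM_bound_of_gaugeOrbit_small_field)
open Literature.MathematicalPhysics.QuantumFieldTheory.Balaban1983to89.B9Eq334LaplaceACovariance (hpos_gaugeU)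
open Literature.MathematicalPhysics.QuantumFieldTheory.Balaban1983to89.B11Eq118RegimeScalars (exists_twoRegimes_radii_of_bounds)
open B9Eq310HessianOperator (adTransportW)

/-- **THE CHART OF THE CURVE SPECIES EXISTS ON ONE AND THE SAME BALL AT EVERY BACKGROUND `U^g` GAUGE-EQUIVALENT TO A SMALL FIELD `U` OF A FIXED
LATTICE** — the host leaf's `cur_chart_exists_of_small_field_uniform` with the background `U` of the CONCLUSION replaced by `gaugeU g U` (`g(x) ∈ U1`
unitary, `τ`-central, fibrewise isometric; the regularity witnesses `hU1′ hreg′` of `U^g` arbitrary at the same `α`): positivity `hpos′` of `Δ_a(U^g)`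
([Balaban1985BackgroundPropagators] Thm 3.11, TRANSFERRED by (3.34)), and lit-balaban's chart (174)∘(47) of `cur (U^g)` Fréchet-differentiable on
`ball 0 R_b`, into `ball 0 R′`, fixing `0`.  MECHANISM in the module docstring: `hpos` by `B9Eq334LaplaceACovariance.hpos_gaugeU`, the letters' operator
norms by `B9Eq3126H1BoundGaugeOrbit` (gauge-INVARIANT), `C(U^g)`'s U-free constants, the host leaf's regime scalars, `chartHB_triple_of_twoRegimes`.
NOT print's uniformity in the lattice; NOT the (L3) `W`; NOT p. 416's per-cube locality reduction. [folklore] -/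
theorem cur_chart_exists_of_gaugeOrbit_small_field {d : ℕ} (L : ℕ) [NeZero L] (m : Fin d → ℕ) [∀ i, NeZero (fineP L m i)] (hL : 1 ≤ L)
    {𝔸 : Type*} [NormedRing 𝔸] [NormedAlgebra ℂ 𝔸] [CompleteSpace 𝔸] [NormOneClass 𝔸] [StarRing 𝔸] [NormedStarGroup 𝔸] [StarModule ℂ 𝔸]
    [FiniteDimensional ℂ 𝔸]
    {W : Type*} [NormedAddCommGroup W] [InnerProductSpace ℂ W] [FiniteDimensional ℂ W] (φ : W ≃ₗ[ℂ] 𝔸) {Mφ Mφ' : ℝ} (hMφ : 0 ≤ Mφ)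
    (hMφ' : 0 ≤ Mφ') (hφ : ∀ w, ‖φ w‖ ≤ Mφ * ‖w‖) (hφ' : ∀ X, ‖φ.symm X‖ ≤ Mφ' * ‖X‖)
    (τ : 𝔸 →ₗ[ℂ] ℂ) {Cτ : ℝ} (hτ : ∀ X, ‖τ X‖ ≤ Cτ * ‖X‖) (hCτ : 0 ≤ Cτ)
    {η : ℝ} [Fact (0 < (L : ℝ))] [Fact (0 < η)] {lev₀ : Bond d (fineP L m) → ℕ} {levB : Bond d m → ℕ} (lev₁ : Bond d (fineP L m) × Fin d → ℕ)
    (hlev : ∀ b, 1 ≤ lev₀ b) {c₀ c₁ : ℝ} [Fact (0 < c₀)] [Fact (0 < c₁)] {a : ℝ} (ha : 0 < a) {C₄ a₃ : ℝ} (hC₄ : 0 ≤ C₄) (ha₃ : 0 < a₃) :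
    ∃ ε₃ ε₄ εC Rb R' : ℝ, 0 < ε₃ ∧ 0 < Rb ∧ 0 < R' ∧ ∀ (U : Bond d (fineP L m) → 𝔸ˣ) {α : ℝ} (hα : α ≤ 1 / 128) (hα1 : α ≤ 1 / 64)
      (hU1 : ∀ (x : B7Prop1Explicit.Site d) (κ : Fin d), perCfg (fineP L m) U x κ ∈ U1 𝔸)
      (hreg : ∀ (y : TSite d m) (κ : Fin d) (r : Fin d → Fin L),
        ‖((Wcx L (perCfg (fineP L m) U) (cornerSite L y) κ (boxVec L r) : 𝔸ˣ) : 𝔸) - 1‖ ≤ α)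
      (hαL : 50 * (d + 1) * α * (L : ℝ) ^ d ≤ 1 / 2)
      {ε : ℝ}, 0 ≤ ε → ε ≤ ε₃ → (∀ b, ‖(U b : 𝔸) - 1‖ ≤ ε) →
      (∀ (b : Bond d (fineP L m)) (v u : W), inner ℂ (adTransportW φ U b v) u = inner ℂ v (adTransportW φ (fun b => (U b)⁻¹) b u)) →
      ∀ {g : TSite d (fineP L m) → 𝔸ˣ}, (∀ x, g x ∈ U1 𝔸) → (∀ x, star (g x : 𝔸) = ((g x)⁻¹ : 𝔸ˣ)) →
        (∀ (x : TSite d (fineP L m)) (X : 𝔸), τ (AdA (g x) X) = τ X) →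
        (∀ (x : TSite d (fineP L m)) (v v' : W), inner ℂ (AdW φ (g x) v) (AdW φ (g x) v') = inner ℂ v v') →
      ∀ (hU1' : ∀ (x : B7Prop1Explicit.Site d) (κ : Fin d), perCfg (fineP L m) (gaugeU g U) x κ ∈ U1 𝔸)
        (hreg' : ∀ (y : TSite d m) (κ : Fin d) (r : Fin d → Fin L),
          ‖((Wcx L (perCfg (fineP L m) (gaugeU g U)) (cornerSite L y) κ (boxVec L r) : 𝔸ˣ) : 𝔸) - 1‖ ≤ α),
      ∀ {Wq : Space115 (L : ℝ) η lev₀ lev₁ (nabla115 η (gaugeU g U)) → NegSize (L : ℝ) η lev₀ 3 𝔸}, QuadAnalytic Wq C₄ a₃ →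
        AnalyticOnNhd ℂ Wq {Y | ‖Y‖ < a₃} →
      ∃ hpos' : ∀ x : BondL2K ℂ d (fineP L m) c₀ W, x ≠ 0 →
          0 < RCLike.re (inner ℂ x (laplaceAofBackground L m hL φ (gaugeU g U) hα1 hU1' hreg' τ η (c₀ := c₀) (c₁ := c₁) a x)),
        DifferentiableOn ℂ (chartHB (frakGLatticeCLM (lev₀ := lev₀) φ hpos' (QtorusW_surjective L m hL (gaugeU g U) hα1 hU1' hreg' hαL φ) lev₁
              (nabla115 η (gaugeU g U)))
            0 Wq 0 (fun A' => A' + solA (H1LatticeCLM (lev₀ := lev₀) (levB := levB) φ hpos' (QtorusW_surjective L m hL (gaugeU g U) hα1 hU1' hreg' hαL φ)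
              lev₁ (nabla115 η (gaugeU g U))) 0 (Cc L m η (gaugeU g U) lev₀ lev₁ (nabla115 η (gaugeU g U)) levB) 0 εC A') ε₄
            (H1LatticeCLM (lev₀ := lev₀) (levB := levB) φ hpos' (QtorusW_surjective L m hL (gaugeU g U) hα1 hU1' hreg' hαL φ) lev₁
              (nabla115 η (gaugeU g U))))
          (ball (0 : NegSize (L : ℝ) η levB 0 𝔸) Rb) ∧
        MapsTo (chartHB (frakGLatticeCLM (lev₀ := lev₀) φ hpos' (QtorusW_surjective L m hL (gaugeU g U) hα1 hU1' hreg' hαL φ) lev₁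
              (nabla115 η (gaugeU g U)))
            0 Wq 0 (fun A' => A' + solA (H1LatticeCLM (lev₀ := lev₀) (levB := levB) φ hpos' (QtorusW_surjective L m hL (gaugeU g U) hα1 hU1' hreg' hαL φ)
              lev₁ (nabla115 η (gaugeU g U))) 0 (Cc L m η (gaugeU g U) lev₀ lev₁ (nabla115 η (gaugeU g U)) levB) 0 εC A') ε₄
            (H1LatticeCLM (lev₀ := lev₀) (levB := levB) φ hpos' (QtorusW_surjective L m hL (gaugeU g U) hα1 hU1' hreg' hαL φ) lev₁
              (nabla115 η (gaugeU g U))))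
          (ball (0 : NegSize (L : ℝ) η levB 0 𝔸) Rb) (ball (0 : Space115 (L : ℝ) η lev₀ lev₁ (nabla115 η (gaugeU g U))) R') ∧
        chartHB (frakGLatticeCLM (lev₀ := lev₀) φ hpos' (QtorusW_surjective L m hL (gaugeU g U) hα1 hU1' hreg' hαL φ) lev₁
              (nabla115 η (gaugeU g U)))
            0 Wq 0 (fun A' => A' + solA (H1LatticeCLM (lev₀ := lev₀) (levB := levB) φ hpos' (QtorusW_surjective L m hL (gaugeU g U) hα1 hU1' hreg' hαL φ)
              lev₁ (nabla115 η (gaugeU g U))) 0 (Cc L m η (gaugeU g U) lev₀ lev₁ (nabla115 η (gaugeU g U)) levB) 0 εC A') ε₄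
            (H1LatticeCLM (lev₀ := lev₀) (levB := levB) φ hpos' (QtorusW_surjective L m hL (gaugeU g U) hα1 hU1' hreg' hαL φ) lev₁
              (nabla115 η (gaugeU g U))) 0 = 0 := by
  -- Thm 3.11 at every small field (owner gen 80), to be transferred along the orbit by (3.34)
  obtain ⟨ε₃, hε₃, Hpos⟩ := laplaceAofBackground_pos_of_small_field L m hL φ (c₀ := c₀) (c₁ := c₁) (ne_of_gt (Fact.out : 0 < η)) ha hMφ hMφ' hφ hφ'
    τ hτ hCτ
  -- the operator-norm bounds of `H₁`, `𝔊` in the chart's type ON THE GAUGE ORBIT (NE9 leaf-03 gen 60, on the owner's (K))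
  obtain ⟨CH, CG, ε₅, hCH, hCG, hε₅, Hb⟩ :=
    exists_H1_frakG_CLM_bound_of_gaugeOrbit_small_field L m hL φ (c₀ := c₀) (c₁ := c₁) (η := η) lev₀ levB lev₁ ha hMφ hMφ' hφ hφ' τ hτ hCτ
  -- the scalar letters of the two regimes from the bounds (`C`'s constants are U-free)
  obtain ⟨j, a', ε₄, aC, εC, R', Rb, hj, ha', -, -, -, hR'0, hRb0, hcap, hR'le, Hreg⟩ :=
    exists_twoRegimes_radii_of_bounds (B₀ := CG) (b := CH) (b₁ := CH) (C₄ := C₄) (a₃ := a₃) (C₂ := 2097152 * ((d : ℝ) + 1) ^ 2)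
      (c₄ := 1 / (512 * ((d : ℝ) + 1))) hCG.le hCH.le hCH.le hC₄ ha₃ (by positivity) (by positivity)
  refine ⟨min ε₃ ε₅, ε₄, εC, Rb, R', lt_min hε₃ hε₅, hRb0, hR'0, ?_⟩
  intro U α hα hα1 hU1 hreg hαL ε hε hεm hUε hRS g hg hstar hτg hAd hU1' hreg' Wq hW hWa
  -- positivity at `U`, then at `U^g`
  have hpos := Hpos U hα1 hU1 hreg hε (hεm.trans (min_le_left _ _)) hUε hRS
  have hpos' : ∀ x : BondL2K ℂ d (fineP L m) c₀ W, x ≠ 0 →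
      0 < RCLike.re (inner ℂ x (laplaceAofBackground L m hL φ (gaugeU g U) hα1 hU1' hreg' τ η (c₀ := c₀) (c₁ := c₁) a x)) :=
    hpos_gaugeU L m hL φ U hα1 hU1 hreg hU1' hreg' τ η hτg hstar hAd a hpos
  refine ⟨hpos', ?_⟩
  obtain ⟨hH, hG⟩ := Hb U hα1 hU1 hreg hε (hεm.trans (min_le_right _ _)) hUε hRS hpos (QtorusW_surjective L m hL U hα1 hU1 hreg hαL φ) hg hstar hτg
    hAd hU1' hreg' hpos' (QtorusW_surjective L m hL (gaugeU g U) hα1 hU1' hreg' hαL φ)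
  have hC := quadAnalytic_Cc L m η (gaugeU g U) lev₀ lev₁ (nabla115 η (gaugeU g U)) levB hL hα hU1' hreg' hlev
  have hCa := analyticOnNhd_Cc L m η (gaugeU g U) lev₀ lev₁ (nabla115 η (gaugeU g U)) levB hL hα hU1' hreg' hlev
  have hHpt : ∀ B : NegSize (L : ℝ) η levB 0 𝔸,
      ‖H1LatticeCLM (lev₀ := lev₀) (levB := levB) φ hpos' (QtorusW_surjective L m hL (gaugeU g U) hα1 hU1' hreg' hαL φ) lev₁
        (nabla115 η (gaugeU g U)) B‖ ≤ CH * ‖B‖ :=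
    fun B => (ContinuousLinearMap.le_opNorm _ B).trans (mul_le_mul_of_nonneg_right hH (norm_nonneg B))
  have hGpt : ∀ f : NegSize (L : ℝ) η lev₀ 3 𝔸,
      ‖frakGLatticeCLM (lev₀ := lev₀) φ hpos' (QtorusW_surjective L m hL (gaugeU g U) hα1 hU1' hreg' hαL φ) lev₁ (nabla115 η (gaugeU g U)) f‖ ≤
        CG * ‖f‖ :=
    fun f => (ContinuousLinearMap.le_opNorm _ f).trans (mul_le_mul_of_nonneg_right hG (norm_nonneg f))
  obtain ⟨R, RC, hRb⟩ := Hreg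
    (frakGLatticeCLM (lev₀ := lev₀) φ hpos' (QtorusW_surjective L m hL (gaugeU g U) hα1 hU1' hreg' hαL φ) lev₁ (nabla115 η (gaugeU g U))) Wq
    (H1LatticeCLM (lev₀ := lev₀) (levB := levB) φ hpos' (QtorusW_surjective L m hL (gaugeU g U) hα1 hU1' hreg' hαL φ) lev₁ (nabla115 η (gaugeU g U)))
    (Cc L m η (gaugeU g U) lev₀ lev₁ (nabla115 η (gaugeU g U)) levB)
    (H1LatticeCLM (lev₀ := lev₀) (levB := levB) φ hpos' (QtorusW_surjective L m hL (gaugeU g U) hα1 hU1' hreg' hαL φ) lev₁ (nabla115 η (gaugeU g U)))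
    hGpt hW hHpt hC hHpt
  exact chartHB_triple_of_twoRegimes R hWa hj.le ha' RC hCa hcap _ hRb hR'0 hR'le

/-- **THE SAME WITH `∃ ε₃` BEFORE THE W-SLOT CONSTANTS `(C₄, a₃)`** (the host leaf's v1.1 order, reader ne9-leaf-06 W-5): the background threshold
`ε₃` does not depend on the quadratic-analyticity constants of the (L3) slot, so it is quantified first; the radii after `∀ C₄ a₃` and before `∀ U ∀ g`.
Same proof, reordered. [folklore] -/
theorem cur_chart_exists_of_gaugeOrbit_small_field' {d : ℕ} (L : ℕ) [NeZero L] (m : Fin d → ℕ) [∀ i, NeZero (fineP L m i)] (hL : 1 ≤ L)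
    {𝔸 : Type*} [NormedRing 𝔸] [NormedAlgebra ℂ 𝔸] [CompleteSpace 𝔸] [NormOneClass 𝔸] [StarRing 𝔸] [NormedStarGroup 𝔸] [StarModule ℂ 𝔸]
    [FiniteDimensional ℂ 𝔸]
    {W : Type*} [NormedAddCommGroup W] [InnerProductSpace ℂ W] [FiniteDimensional ℂ W] (φ : W ≃ₗ[ℂ] 𝔸) {Mφ Mφ' : ℝ} (hMφ : 0 ≤ Mφ)
    (hMφ' : 0 ≤ Mφ') (hφ : ∀ w, ‖φ w‖ ≤ Mφ * ‖w‖) (hφ' : ∀ X, ‖φ.symm X‖ ≤ Mφ' * ‖X‖)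
    (τ : 𝔸 →ₗ[ℂ] ℂ) {Cτ : ℝ} (hτ : ∀ X, ‖τ X‖ ≤ Cτ * ‖X‖) (hCτ : 0 ≤ Cτ)
    {η : ℝ} [Fact (0 < (L : ℝ))] [Fact (0 < η)] {lev₀ : Bond d (fineP L m) → ℕ} {levB : Bond d m → ℕ} (lev₁ : Bond d (fineP L m) × Fin d → ℕ)
    (hlev : ∀ b, 1 ≤ lev₀ b) {c₀ c₁ : ℝ} [Fact (0 < c₀)] [Fact (0 < c₁)] {a : ℝ} (ha : 0 < a) :
    ∃ ε₃ : ℝ, 0 < ε₃ ∧ ∀ {C₄ a₃ : ℝ}, 0 ≤ C₄ → 0 < a₃ →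
      ∃ ε₄ εC Rb R' : ℝ, 0 < Rb ∧ 0 < R' ∧ ∀ (U : Bond d (fineP L m) → 𝔸ˣ) {α : ℝ} (hα : α ≤ 1 / 128) (hα1 : α ≤ 1 / 64)
      (hU1 : ∀ (x : B7Prop1Explicit.Site d) (κ : Fin d), perCfg (fineP L m) U x κ ∈ U1 𝔸)
      (hreg : ∀ (y : TSite d m) (κ : Fin d) (r : Fin d → Fin L),
        ‖((Wcx L (perCfg (fineP L m) U) (cornerSite L y) κ (boxVec L r) : 𝔸ˣ) : 𝔸) - 1‖ ≤ α)
      (hαL : 50 * (d + 1) * α * (L : ℝ) ^ d ≤ 1 / 2)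
      {ε : ℝ}, 0 ≤ ε → ε ≤ ε₃ → (∀ b, ‖(U b : 𝔸) - 1‖ ≤ ε) →
      (∀ (b : Bond d (fineP L m)) (v u : W), inner ℂ (adTransportW φ U b v) u = inner ℂ v (adTransportW φ (fun b => (U b)⁻¹) b u)) →
      ∀ {g : TSite d (fineP L m) → 𝔸ˣ}, (∀ x, g x ∈ U1 𝔸) → (∀ x, star (g x : 𝔸) = ((g x)⁻¹ : 𝔸ˣ)) →
        (∀ (x : TSite d (fineP L m)) (X : 𝔸), τ (AdA (g x) X) = τ X) →
        (∀ (x : TSite d (fineP L m)) (v v' : W), inner ℂ (AdW φ (g x) v) (AdW φ (g x) v') = inner ℂ v v') →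
      ∀ (hU1' : ∀ (x : B7Prop1Explicit.Site d) (κ : Fin d), perCfg (fineP L m) (gaugeU g U) x κ ∈ U1 𝔸)
        (hreg' : ∀ (y : TSite d m) (κ : Fin d) (r : Fin d → Fin L),
          ‖((Wcx L (perCfg (fineP L m) (gaugeU g U)) (cornerSite L y) κ (boxVec L r) : 𝔸ˣ) : 𝔸) - 1‖ ≤ α),
      ∀ {Wq : Space115 (L : ℝ) η lev₀ lev₁ (nabla115 η (gaugeU g U)) → NegSize (L : ℝ) η lev₀ 3 𝔸}, QuadAnalytic Wq C₄ a₃ →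
        AnalyticOnNhd ℂ Wq {Y | ‖Y‖ < a₃} →
      ∃ hpos' : ∀ x : BondL2K ℂ d (fineP L m) c₀ W, x ≠ 0 →
          0 < RCLike.re (inner ℂ x (laplaceAofBackground L m hL φ (gaugeU g U) hα1 hU1' hreg' τ η (c₀ := c₀) (c₁ := c₁) a x)),
        DifferentiableOn ℂ (chartHB (frakGLatticeCLM (lev₀ := lev₀) φ hpos' (QtorusW_surjective L m hL (gaugeU g U) hα1 hU1' hreg' hαL φ) lev₁
              (nabla115 η (gaugeU g U)))
            0 Wq 0 (fun A' => A' + solA (H1LatticeCLM (lev₀ := lev₀) (levB := levB) φ hpos' (QtorusW_surjective L m hL (gaugeU g U) hα1 hU1' hreg' hαL φ)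
              lev₁ (nabla115 η (gaugeU g U))) 0 (Cc L m η (gaugeU g U) lev₀ lev₁ (nabla115 η (gaugeU g U)) levB) 0 εC A') ε₄
            (H1LatticeCLM (lev₀ := lev₀) (levB := levB) φ hpos' (QtorusW_surjective L m hL (gaugeU g U) hα1 hU1' hreg' hαL φ) lev₁
              (nabla115 η (gaugeU g U))))
          (ball (0 : NegSize (L : ℝ) η levB 0 𝔸) Rb) ∧
        MapsTo (chartHB (frakGLatticeCLM (lev₀ := lev₀) φ hpos' (QtorusW_surjective L m hL (gaugeU g U) hα1 hU1' hreg' hαL φ) lev₁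
              (nabla115 η (gaugeU g U)))
            0 Wq 0 (fun A' => A' + solA (H1LatticeCLM (lev₀ := lev₀) (levB := levB) φ hpos' (QtorusW_surjective L m hL (gaugeU g U) hα1 hU1' hreg' hαL φ)
              lev₁ (nabla115 η (gaugeU g U))) 0 (Cc L m η (gaugeU g U) lev₀ lev₁ (nabla115 η (gaugeU g U)) levB) 0 εC A') ε₄
            (H1LatticeCLM (lev₀ := lev₀) (levB := levB) φ hpos' (QtorusW_surjective L m hL (gaugeU g U) hα1 hU1' hreg' hαL φ) lev₁
              (nabla115 η (gaugeU g U))))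
          (ball (0 : NegSize (L : ℝ) η levB 0 𝔸) Rb) (ball (0 : Space115 (L : ℝ) η lev₀ lev₁ (nabla115 η (gaugeU g U))) R') ∧
        chartHB (frakGLatticeCLM (lev₀ := lev₀) φ hpos' (QtorusW_surjective L m hL (gaugeU g U) hα1 hU1' hreg' hαL φ) lev₁
              (nabla115 η (gaugeU g U)))
            0 Wq 0 (fun A' => A' + solA (H1LatticeCLM (lev₀ := lev₀) (levB := levB) φ hpos' (QtorusW_surjective L m hL (gaugeU g U) hα1 hU1' hreg' hαL φ)
              lev₁ (nabla115 η (gaugeU g U))) 0 (Cc L m η (gaugeU g U) lev₀ lev₁ (nabla115 η (gaugeU g U)) levB) 0 εC A') ε₄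
            (H1LatticeCLM (lev₀ := lev₀) (levB := levB) φ hpos' (QtorusW_surjective L m hL (gaugeU g U) hα1 hU1' hreg' hαL φ) lev₁
              (nabla115 η (gaugeU g U))) 0 = 0 := by
  -- Thm 3.11 at every small field (owner gen 80), to be transferred along the orbit by (3.34)
  obtain ⟨ε₃, hε₃, Hpos⟩ := laplaceAofBackground_pos_of_small_field L m hL φ (c₀ := c₀) (c₁ := c₁) (ne_of_gt (Fact.out : 0 < η)) ha hMφ hMφ' hφ hφ'
    τ hτ hCτ
  -- the operator-norm bounds of `H₁`, `𝔊` in the chart's type ON THE GAUGE ORBIT (NE9 leaf-03 gen 60, on the owner's (K))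
  obtain ⟨CH, CG, ε₅, hCH, hCG, hε₅, Hb⟩ :=
    exists_H1_frakG_CLM_bound_of_gaugeOrbit_small_field L m hL φ (c₀ := c₀) (c₁ := c₁) (η := η) lev₀ levB lev₁ ha hMφ hMφ' hφ hφ' τ hτ hCτ
  -- `ε₃` BEFORE the W-slot constants; then the scalar letters of the two regimes from the bounds and `(C₄, a₃)`
  refine ⟨min ε₃ ε₅, lt_min hε₃ hε₅, fun {C₄ a₃} hC₄ ha₃ => ?_⟩
  obtain ⟨j, a', ε₄, aC, εC, R', Rb, hj, ha', -, -, -, hR'0, hRb0, hcap, hR'le, Hreg⟩ :=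
    exists_twoRegimes_radii_of_bounds (B₀ := CG) (b := CH) (b₁ := CH) (C₄ := C₄) (a₃ := a₃) (C₂ := 2097152 * ((d : ℝ) + 1) ^ 2)
      (c₄ := 1 / (512 * ((d : ℝ) + 1))) hCG.le hCH.le hCH.le hC₄ ha₃ (by positivity) (by positivity)
  refine ⟨ε₄, εC, Rb, R', hRb0, hR'0, ?_⟩
  intro U α hα hα1 hU1 hreg hαL ε hε hεm hUε hRS g hg hstar hτg hAd hU1' hreg' Wq hW hWa
  -- positivity at `U`, then at `U^g`
  have hpos := Hpos U hα1 hU1 hreg hε (hεm.trans (min_le_left _ _)) hUε hRS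
  have hpos' : ∀ x : BondL2K ℂ d (fineP L m) c₀ W, x ≠ 0 →
      0 < RCLike.re (inner ℂ x (laplaceAofBackground L m hL φ (gaugeU g U) hα1 hU1' hreg' τ η (c₀ := c₀) (c₁ := c₁) a x)) :=
    hpos_gaugeU L m hL φ U hα1 hU1 hreg hU1' hreg' τ η hτg hstar hAd a hpos
  refine ⟨hpos', ?_⟩
  obtain ⟨hH, hG⟩ := Hb U hα1 hU1 hreg hε (hεm.trans (min_le_right _ _)) hUε hRS hpos (QtorusW_surjective L m hL U hα1 hU1 hreg hαL φ) hg hstar hτg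
    hAd hU1' hreg' hpos' (QtorusW_surjective L m hL (gaugeU g U) hα1 hU1' hreg' hαL φ)
  have hC := quadAnalytic_Cc L m η (gaugeU g U) lev₀ lev₁ (nabla115 η (gaugeU g U)) levB hL hα hU1' hreg' hlev
  have hCa := analyticOnNhd_Cc L m η (gaugeU g U) lev₀ lev₁ (nabla115 η (gaugeU g U)) levB hL hα hU1' hreg' hlev
  have hHpt : ∀ B : NegSize (L : ℝ) η levB 0 𝔸,
      ‖H1LatticeCLM (lev₀ := lev₀) (levB := levB) φ hpos' (QtorusW_surjective L m hL (gaugeU g U) hα1 hU1' hreg' hαL φ) lev₁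
        (nabla115 η (gaugeU g U)) B‖ ≤ CH * ‖B‖ :=
    fun B => (ContinuousLinearMap.le_opNorm _ B).trans (mul_le_mul_of_nonneg_right hH (norm_nonneg B))
  have hGpt : ∀ f : NegSize (L : ℝ) η lev₀ 3 𝔸,
      ‖frakGLatticeCLM (lev₀ := lev₀) φ hpos' (QtorusW_surjective L m hL (gaugeU g U) hα1 hU1' hreg' hαL φ) lev₁ (nabla115 η (gaugeU g U)) f‖ ≤
        CG * ‖f‖ :=
    fun f => (ContinuousLinearMap.le_opNorm _ f).trans (mul_le_mul_of_nonneg_right hG (norm_nonneg f))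
  obtain ⟨R, RC, hRb⟩ := Hreg
    (frakGLatticeCLM (lev₀ := lev₀) φ hpos' (QtorusW_surjective L m hL (gaugeU g U) hα1 hU1' hreg' hαL φ) lev₁ (nabla115 η (gaugeU g U))) Wq
    (H1LatticeCLM (lev₀ := lev₀) (levB := levB) φ hpos' (QtorusW_surjective L m hL (gaugeU g U) hα1 hU1' hreg' hαL φ) lev₁ (nabla115 η (gaugeU g U)))
    (Cc L m η (gaugeU g U) lev₀ lev₁ (nabla115 η (gaugeU g U)) levB)
    (H1LatticeCLM (lev₀ := lev₀) (levB := levB) φ hpos' (QtorusW_surjective L m hL (gaugeU g U) hα1 hU1' hreg' hαL φ) lev₁ (nabla115 η (gaugeU g U)))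
    hGpt hW hHpt hC hHpt
  exact chartHB_triple_of_twoRegimes R hWa hj.le ha' RC hCa hcap _ hRb hR'0 hR'le


end GaugeOrbit

/-! ## v1.1 (APPEND-ONLY): the same on the gauge orbit of the SMALL-BOND class — binders {`U1`, small bonds, `hRS`∕unitary} at `U` -/

section SmallBonds

open Literature.MathematicalPhysics.QuantumFieldTheory.Balaban1983to89.B9Eq335SmallBondsData
  (perCfg_mem_U1 hreg_of_small_bonds alpha_le_128 alpha_le_64 alphaL_le_half epsReg_pos)
open Literature.MathematicalPhysics.QuantumFieldTheory.Balaban1983to89.B9Thm311SmallFieldClosed (hRS_of_unitary)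
open Literature.MathematicalPhysics.QuantumFieldTheory.Balaban1983to89.B9Eq328GaugeAction (tau_AdA_of_trace inner_AdW_AdW_of_compat)
open Literature.MathematicalPhysics.QuantumFieldTheory.Balaban1983to89.B9Eq333ProjectionCovariance (hU1_gaugeU hreg_gaugeU)
open B9Eq310HessianOperator (adTransportW)

/-- **v1.1 (APPEND-ONLY): THE CHART OF THE CURVE SPECIES ON ONE BALL FOR EVERY `V = U^g` GAUGE-EQUIVALENT, BY A UNIT-BOUNDED UNITARY GAUGE,
TO A UNIT-BOUNDED SMALL-BOND BACKGROUND** — the OWNER's v1.2 `cur_chart_exists_of_small_bonds` hosted on the gauge orbit (his pointer W-ne9p1-g82-1,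
journal l.43195: the three background binders {`U(b) ∈ U1`, `‖U(b) − 1‖ ≤ ε ≤ ε₃ ≤ ε_reg(d, L)`, `hRS`} AT `U` instead of E162's five; the witnesses of
`U` PRODUCED by `B9Eq335SmallBondsData`, those of `U^g` PRODUCED from them by `B9Eq333ProjectionCovariance.hU1_gaugeU/hreg_gaugeU`); gauge binders
{`g(x) ∈ U1`, unitary, `τ`-central, fibrewise isometric}; same `∃`-numbers as `cur_chart_exists_of_gaugeOrbit_small_field'`; conclusion `∃ hpos′` +
(Ψ1)–(Ψ3) at `∇_{U^g}`.  NOT (3.35)'s construction of the small-bond gauge from small plaquettes. [folklore] -/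
theorem cur_chart_exists_of_gaugeOrbit_small_bonds {d : ℕ} (L : ℕ) [NeZero L] (m : Fin d → ℕ) [∀ i, NeZero (fineP L m i)] (hL : 1 ≤ L)
    {𝔸 : Type*} [NormedRing 𝔸] [NormedAlgebra ℂ 𝔸] [CompleteSpace 𝔸] [NormOneClass 𝔸] [StarRing 𝔸] [NormedStarGroup 𝔸] [StarModule ℂ 𝔸]
    [FiniteDimensional ℂ 𝔸]
    {W : Type*} [NormedAddCommGroup W] [InnerProductSpace ℂ W] [FiniteDimensional ℂ W] (φ : W ≃ₗ[ℂ] 𝔸) {Mφ Mφ' : ℝ} (hMφ : 0 ≤ Mφ)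
    (hMφ' : 0 ≤ Mφ') (hφ : ∀ w, ‖φ w‖ ≤ Mφ * ‖w‖) (hφ' : ∀ X, ‖φ.symm X‖ ≤ Mφ' * ‖X‖)
    (τ : 𝔸 →ₗ[ℂ] ℂ) {Cτ : ℝ} (hτ : ∀ X, ‖τ X‖ ≤ Cτ * ‖X‖) (hCτ : 0 ≤ Cτ)
    {η : ℝ} [Fact (0 < (L : ℝ))] [Fact (0 < η)] {lev₀ : Bond d (fineP L m) → ℕ} {levB : Bond d m → ℕ} (lev₁ : Bond d (fineP L m) × Fin d → ℕ)
    (hlev : ∀ b, 1 ≤ lev₀ b) {c₀ c₁ : ℝ} [Fact (0 < c₀)] [Fact (0 < c₁)] {a : ℝ} (ha : 0 < a) :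
    ∃ ε₃ : ℝ, 0 < ε₃ ∧ ε₃ ≤ 1 / (256 * ((d : ℝ) + 1) ^ 2 * (L : ℝ) ^ (d + 1)) ∧ ∀ {C₄ a₃ : ℝ}, 0 ≤ C₄ → 0 < a₃ →
      ∃ ε₄ εC Rb R' : ℝ, 0 < Rb ∧ 0 < R' ∧ ∀ (U : Bond d (fineP L m) → 𝔸ˣ) (hU : ∀ b, U b ∈ U1 𝔸) {ε : ℝ} (hε : 0 ≤ ε)
      (hεr : ε ≤ 1 / (256 * ((d : ℝ) + 1) ^ 2 * (L : ℝ) ^ (d + 1))), ε ≤ ε₃ → ∀ (hUε : ∀ b, ‖(U b : 𝔸) - 1‖ ≤ ε),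
      (∀ (b : Bond d (fineP L m)) (v u : W), inner ℂ (adTransportW φ U b v) u = inner ℂ v (adTransportW φ (fun b => (U b)⁻¹) b u)) →
      ∀ {g : TSite d (fineP L m) → 𝔸ˣ} (hg : ∀ x, g x ∈ U1 𝔸), (∀ x, star (g x : 𝔸) = ((g x)⁻¹ : 𝔸ˣ)) →
        (∀ (x : TSite d (fineP L m)) (X : 𝔸), τ (AdA (g x) X) = τ X) →
        (∀ (x : TSite d (fineP L m)) (v v' : W), inner ℂ (AdW φ (g x) v) (AdW φ (g x) v') = inner ℂ v v') →
      ∀ {Wq : Space115 (L : ℝ) η lev₀ lev₁ (nabla115 η (gaugeU g U)) → NegSize (L : ℝ) η lev₀ 3 𝔸}, QuadAnalytic Wq C₄ a₃ →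
        AnalyticOnNhd ℂ Wq {Y | ‖Y‖ < a₃} →
      ∃ hpos : ∀ x : BondL2K ℂ d (fineP L m) c₀ W, x ≠ 0 →
          0 < RCLike.re (inner ℂ x (laplaceAofBackground L m hL φ (gaugeU g U) (alpha_le_64 hL hε hεr)
            (hU1_gaugeU L m g U hg (perCfg_mem_U1 L m hU)) (hreg_gaugeU L m g U hg (hreg_of_small_bonds L m hU hε hUε)) τ η (c₀ := c₀) (c₁ := c₁) a x)),
        DifferentiableOn ℂ (chartHB (frakGLatticeCLM (lev₀ := lev₀) φ hpos (QtorusW_surjective L m hL (gaugeU g U) (alpha_le_64 hL hε hεr)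
              (hU1_gaugeU L m g U hg (perCfg_mem_U1 L m hU)) (hreg_gaugeU L m g U hg (hreg_of_small_bonds L m hU hε hUε)) (alphaL_le_half hL hεr) φ) lev₁ (nabla115 η (gaugeU g U)))
            0 Wq 0 (fun A' => A' + solA (H1LatticeCLM (lev₀ := lev₀) (levB := levB) φ hpos (QtorusW_surjective L m hL (gaugeU g U) (alpha_le_64 hL hε hεr)
              (hU1_gaugeU L m g U hg (perCfg_mem_U1 L m hU)) (hreg_gaugeU L m g U hg (hreg_of_small_bonds L m hU hε hUε)) (alphaL_le_half hL hεr) φ) lev₁ (nabla115 η (gaugeU g U)))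
              0 (Cc L m η (gaugeU g U) lev₀ lev₁ (nabla115 η (gaugeU g U)) levB) 0 εC A') ε₄
            (H1LatticeCLM (lev₀ := lev₀) (levB := levB) φ hpos (QtorusW_surjective L m hL (gaugeU g U) (alpha_le_64 hL hε hεr)
              (hU1_gaugeU L m g U hg (perCfg_mem_U1 L m hU)) (hreg_gaugeU L m g U hg (hreg_of_small_bonds L m hU hε hUε)) (alphaL_le_half hL hεr) φ) lev₁ (nabla115 η (gaugeU g U))))
          (ball (0 : NegSize (L : ℝ) η levB 0 𝔸) Rb) ∧
        MapsTo (chartHB (frakGLatticeCLM (lev₀ := lev₀) φ hpos (QtorusW_surjective L m hL (gaugeU g U) (alpha_le_64 hL hε hεr)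
              (hU1_gaugeU L m g U hg (perCfg_mem_U1 L m hU)) (hreg_gaugeU L m g U hg (hreg_of_small_bonds L m hU hε hUε)) (alphaL_le_half hL hεr) φ) lev₁ (nabla115 η (gaugeU g U)))
            0 Wq 0 (fun A' => A' + solA (H1LatticeCLM (lev₀ := lev₀) (levB := levB) φ hpos (QtorusW_surjective L m hL (gaugeU g U) (alpha_le_64 hL hε hεr)
              (hU1_gaugeU L m g U hg (perCfg_mem_U1 L m hU)) (hreg_gaugeU L m g U hg (hreg_of_small_bonds L m hU hε hUε)) (alphaL_le_half hL hεr) φ) lev₁ (nabla115 η (gaugeU g U)))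
              0 (Cc L m η (gaugeU g U) lev₀ lev₁ (nabla115 η (gaugeU g U)) levB) 0 εC A') ε₄
            (H1LatticeCLM (lev₀ := lev₀) (levB := levB) φ hpos (QtorusW_surjective L m hL (gaugeU g U) (alpha_le_64 hL hε hεr)
              (hU1_gaugeU L m g U hg (perCfg_mem_U1 L m hU)) (hreg_gaugeU L m g U hg (hreg_of_small_bonds L m hU hε hUε)) (alphaL_le_half hL hεr) φ) lev₁ (nabla115 η (gaugeU g U))))
          (ball (0 : NegSize (L : ℝ) η levB 0 𝔸) Rb) (ball (0 : Space115 (L : ℝ) η lev₀ lev₁ (nabla115 η (gaugeU g U))) R') ∧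
        chartHB (frakGLatticeCLM (lev₀ := lev₀) φ hpos (QtorusW_surjective L m hL (gaugeU g U) (alpha_le_64 hL hε hεr)
              (hU1_gaugeU L m g U hg (perCfg_mem_U1 L m hU)) (hreg_gaugeU L m g U hg (hreg_of_small_bonds L m hU hε hUε)) (alphaL_le_half hL hεr) φ) lev₁ (nabla115 η (gaugeU g U)))
            0 Wq 0 (fun A' => A' + solA (H1LatticeCLM (lev₀ := lev₀) (levB := levB) φ hpos (QtorusW_surjective L m hL (gaugeU g U) (alpha_le_64 hL hε hεr)
              (hU1_gaugeU L m g U hg (perCfg_mem_U1 L m hU)) (hreg_gaugeU L m g U hg (hreg_of_small_bonds L m hU hε hUε)) (alphaL_le_half hL hεr) φ) lev₁ (nabla115 η (gaugeU g U)))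
              0 (Cc L m η (gaugeU g U) lev₀ lev₁ (nabla115 η (gaugeU g U)) levB) 0 εC A') ε₄
            (H1LatticeCLM (lev₀ := lev₀) (levB := levB) φ hpos (QtorusW_surjective L m hL (gaugeU g U) (alpha_le_64 hL hε hεr)
              (hU1_gaugeU L m g U hg (perCfg_mem_U1 L m hU)) (hreg_gaugeU L m g U hg (hreg_of_small_bonds L m hU hε hUε)) (alphaL_le_half hL hεr) φ) lev₁ (nabla115 η (gaugeU g U))) 0 = 0 := by
  obtain ⟨ε₃, hε₃, H⟩ := cur_chart_exists_of_gaugeOrbit_small_field' L m hL φ hMφ hMφ' hφ hφ' τ hτ hCτ (η := η) (levB := levB) lev₁ hlev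
    (c₀ := c₀) (c₁ := c₁) ha
  refine ⟨min ε₃ (1 / (256 * ((d : ℝ) + 1) ^ 2 * (L : ℝ) ^ (d + 1))), lt_min hε₃ (epsReg_pos hL), min_le_right _ _, fun {C₄ a₃} hC₄ ha₃ => ?_⟩
  obtain ⟨ε₄, εC, Rb, R', hRb0, hR'0, H'⟩ := H hC₄ ha₃
  refine ⟨ε₄, εC, Rb, R', hRb0, hR'0, ?_⟩
  intro U hU ε hε hεr hεm hUε hRS g hg hstar hτg hAd Wq hW hWa
  exact H' U (alpha_le_128 hL hε hεr) (alpha_le_64 hL hε hεr) (perCfg_mem_U1 L m hU) (hreg_of_small_bonds L m hU hε hUε)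
    (alphaL_le_half hL hεr) hε (hεm.trans (min_le_left _ _)) hUε hRS hg hstar hτg hAd (hU1_gaugeU L m g U hg (perCfg_mem_U1 L m hU))
    (hreg_gaugeU L m g U hg (hreg_of_small_bonds L m hU hε hUε)) hW hWa

/-- **v1.1: THE SAME WITH `hRS`, `hτ`-FOR-`g`, `hAd` DISCHARGED BY THE MODEL LETTERS** (unitary `U(b)` and `g(x)`, tracial `τ`, the norming
`⟨φ⁻¹X, φ⁻¹Y⟩ = τ(X*Y)`: `hRS_of_unitary`, `tau_AdA_of_trace`, `inner_AdW_AdW_of_compat`) — background binders {`U(b) ∈ U1`, unitary,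
`‖U(b) − 1‖ ≤ ε ≤ ε₃`; `g(x) ∈ U1`, unitary} and nothing else (+ the (L3) slot, the fibre∕trace letters). [folklore] -/
theorem cur_chart_exists_of_gaugeOrbit_small_bonds_unitary {d : ℕ} (L : ℕ) [NeZero L] (m : Fin d → ℕ) [∀ i, NeZero (fineP L m i)] (hL : 1 ≤ L)
    {𝔸 : Type*} [NormedRing 𝔸] [NormedAlgebra ℂ 𝔸] [CompleteSpace 𝔸] [NormOneClass 𝔸] [StarRing 𝔸] [NormedStarGroup 𝔸] [StarModule ℂ 𝔸]
    [FiniteDimensional ℂ 𝔸]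
    {W : Type*} [NormedAddCommGroup W] [InnerProductSpace ℂ W] [FiniteDimensional ℂ W] (φ : W ≃ₗ[ℂ] 𝔸) {Mφ Mφ' : ℝ} (hMφ : 0 ≤ Mφ)
    (hMφ' : 0 ≤ Mφ') (hφ : ∀ w, ‖φ w‖ ≤ Mφ * ‖w‖) (hφ' : ∀ X, ‖φ.symm X‖ ≤ Mφ' * ‖X‖)
    (τ : 𝔸 →ₗ[ℂ] ℂ) {Cτ : ℝ} (hτ : ∀ X, ‖τ X‖ ≤ Cτ * ‖X‖) (hCτ : 0 ≤ Cτ)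
    (hτφ : ∀ X Y : 𝔸, inner ℂ (φ.symm X) (φ.symm Y) = τ (star X * Y)) (htr : ∀ X Y : 𝔸, τ (X * Y) = τ (Y * X))
    {η : ℝ} [Fact (0 < (L : ℝ))] [Fact (0 < η)] {lev₀ : Bond d (fineP L m) → ℕ} {levB : Bond d m → ℕ} (lev₁ : Bond d (fineP L m) × Fin d → ℕ)
    (hlev : ∀ b, 1 ≤ lev₀ b) {c₀ c₁ : ℝ} [Fact (0 < c₀)] [Fact (0 < c₁)] {a : ℝ} (ha : 0 < a) :
    ∃ ε₃ : ℝ, 0 < ε₃ ∧ ε₃ ≤ 1 / (256 * ((d : ℝ) + 1) ^ 2 * (L : ℝ) ^ (d + 1)) ∧ ∀ {C₄ a₃ : ℝ}, 0 ≤ C₄ → 0 < a₃ →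
      ∃ ε₄ εC Rb R' : ℝ, 0 < Rb ∧ 0 < R' ∧ ∀ (U : Bond d (fineP L m) → 𝔸ˣ) (hU : ∀ b, U b ∈ U1 𝔸) {ε : ℝ} (hε : 0 ≤ ε)
      (hεr : ε ≤ 1 / (256 * ((d : ℝ) + 1) ^ 2 * (L : ℝ) ^ (d + 1))), ε ≤ ε₃ → ∀ (hUε : ∀ b, ‖(U b : 𝔸) - 1‖ ≤ ε),
      (∀ b, star (U b : 𝔸) = (((U b)⁻¹ : 𝔸ˣ) : 𝔸)) →
      ∀ {g : TSite d (fineP L m) → 𝔸ˣ} (hg : ∀ x, g x ∈ U1 𝔸), (∀ x, star (g x : 𝔸) = ((g x)⁻¹ : 𝔸ˣ)) →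
      ∀ {Wq : Space115 (L : ℝ) η lev₀ lev₁ (nabla115 η (gaugeU g U)) → NegSize (L : ℝ) η lev₀ 3 𝔸}, QuadAnalytic Wq C₄ a₃ →
        AnalyticOnNhd ℂ Wq {Y | ‖Y‖ < a₃} →
      ∃ hpos : ∀ x : BondL2K ℂ d (fineP L m) c₀ W, x ≠ 0 →
          0 < RCLike.re (inner ℂ x (laplaceAofBackground L m hL φ (gaugeU g U) (alpha_le_64 hL hε hεr)
            (hU1_gaugeU L m g U hg (perCfg_mem_U1 L m hU)) (hreg_gaugeU L m g U hg (hreg_of_small_bonds L m hU hε hUε)) τ η (c₀ := c₀) (c₁ := c₁) a x)),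
        DifferentiableOn ℂ (chartHB (frakGLatticeCLM (lev₀ := lev₀) φ hpos (QtorusW_surjective L m hL (gaugeU g U) (alpha_le_64 hL hε hεr)
              (hU1_gaugeU L m g U hg (perCfg_mem_U1 L m hU)) (hreg_gaugeU L m g U hg (hreg_of_small_bonds L m hU hε hUε)) (alphaL_le_half hL hεr) φ) lev₁ (nabla115 η (gaugeU g U)))
            0 Wq 0 (fun A' => A' + solA (H1LatticeCLM (lev₀ := lev₀) (levB := levB) φ hpos (QtorusW_surjective L m hL (gaugeU g U) (alpha_le_64 hL hε hεr)
              (hU1_gaugeU L m g U hg (perCfg_mem_U1 L m hU)) (hreg_gaugeU L m g U hg (hreg_of_small_bonds L m hU hε hUε)) (alphaL_le_half hL hεr) φ) lev₁ (nabla115 η (gaugeU g U)))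
              0 (Cc L m η (gaugeU g U) lev₀ lev₁ (nabla115 η (gaugeU g U)) levB) 0 εC A') ε₄
            (H1LatticeCLM (lev₀ := lev₀) (levB := levB) φ hpos (QtorusW_surjective L m hL (gaugeU g U) (alpha_le_64 hL hε hεr)
              (hU1_gaugeU L m g U hg (perCfg_mem_U1 L m hU)) (hreg_gaugeU L m g U hg (hreg_of_small_bonds L m hU hε hUε)) (alphaL_le_half hL hεr) φ) lev₁ (nabla115 η (gaugeU g U))))
          (ball (0 : NegSize (L : ℝ) η levB 0 𝔸) Rb) ∧
        MapsTo (chartHB (frakGLatticeCLM (lev₀ := lev₀) φ hpos (QtorusW_surjective L m hL (gaugeU g U) (alpha_le_64 hL hε hεr)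
              (hU1_gaugeU L m g U hg (perCfg_mem_U1 L m hU)) (hreg_gaugeU L m g U hg (hreg_of_small_bonds L m hU hε hUε)) (alphaL_le_half hL hεr) φ) lev₁ (nabla115 η (gaugeU g U)))
            0 Wq 0 (fun A' => A' + solA (H1LatticeCLM (lev₀ := lev₀) (levB := levB) φ hpos (QtorusW_surjective L m hL (gaugeU g U) (alpha_le_64 hL hε hεr)
              (hU1_gaugeU L m g U hg (perCfg_mem_U1 L m hU)) (hreg_gaugeU L m g U hg (hreg_of_small_bonds L m hU hε hUε)) (alphaL_le_half hL hεr) φ) lev₁ (nabla115 η (gaugeU g U)))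
              0 (Cc L m η (gaugeU g U) lev₀ lev₁ (nabla115 η (gaugeU g U)) levB) 0 εC A') ε₄
            (H1LatticeCLM (lev₀ := lev₀) (levB := levB) φ hpos (QtorusW_surjective L m hL (gaugeU g U) (alpha_le_64 hL hε hεr)
              (hU1_gaugeU L m g U hg (perCfg_mem_U1 L m hU)) (hreg_gaugeU L m g U hg (hreg_of_small_bonds L m hU hε hUε)) (alphaL_le_half hL hεr) φ) lev₁ (nabla115 η (gaugeU g U))))
          (ball (0 : NegSize (L : ℝ) η levB 0 𝔸) Rb) (ball (0 : Space115 (L : ℝ) η lev₀ lev₁ (nabla115 η (gaugeU g U))) R') ∧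
        chartHB (frakGLatticeCLM (lev₀ := lev₀) φ hpos (QtorusW_surjective L m hL (gaugeU g U) (alpha_le_64 hL hε hεr)
              (hU1_gaugeU L m g U hg (perCfg_mem_U1 L m hU)) (hreg_gaugeU L m g U hg (hreg_of_small_bonds L m hU hε hUε)) (alphaL_le_half hL hεr) φ) lev₁ (nabla115 η (gaugeU g U)))
            0 Wq 0 (fun A' => A' + solA (H1LatticeCLM (lev₀ := lev₀) (levB := levB) φ hpos (QtorusW_surjective L m hL (gaugeU g U) (alpha_le_64 hL hε hεr)
              (hU1_gaugeU L m g U hg (perCfg_mem_U1 L m hU)) (hreg_gaugeU L m g U hg (hreg_of_small_bonds L m hU hε hUε)) (alphaL_le_half hL hεr) φ) lev₁ (nabla115 η (gaugeU g U)))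
              0 (Cc L m η (gaugeU g U) lev₀ lev₁ (nabla115 η (gaugeU g U)) levB) 0 εC A') ε₄
            (H1LatticeCLM (lev₀ := lev₀) (levB := levB) φ hpos (QtorusW_surjective L m hL (gaugeU g U) (alpha_le_64 hL hε hεr)
              (hU1_gaugeU L m g U hg (perCfg_mem_U1 L m hU)) (hreg_gaugeU L m g U hg (hreg_of_small_bonds L m hU hε hUε)) (alphaL_le_half hL hεr) φ) lev₁ (nabla115 η (gaugeU g U))) 0 = 0 := by
  obtain ⟨ε₃, hε₃, hle, H⟩ := cur_chart_exists_of_gaugeOrbit_small_bonds L m hL φ hMφ hMφ' hφ hφ' τ hτ hCτ (η := η) (levB := levB) lev₁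
    hlev (c₀ := c₀) (c₁ := c₁) ha
  refine ⟨ε₃, hε₃, hle, fun {C₄ a₃} hC₄ ha₃ => ?_⟩
  obtain ⟨ε₄, εC, Rb, R', hRb0, hR'0, H'⟩ := H hC₄ ha₃
  refine ⟨ε₄, εC, Rb, R', hRb0, hR'0, ?_⟩
  intro U hU ε hε hεr hεm hUε hUstar g hg hgstar Wq hW hWa
  have hτg : ∀ (x : TSite d (fineP L m)) (X : 𝔸), τ (AdA (g x) X) = τ X := fun x X => tau_AdA_of_trace τ htr (g x) X
  exact H' U hU hε hεr hεm hUε (hRS_of_unitary φ τ hτφ htr U hUstar) hg hgstar hτg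
    (fun x v v' => inner_AdW_AdW_of_compat φ τ hτφ (hτg x) (hgstar x) v v') hW hWa

end SmallBonds

end Summit.QuantumFields.BalabanUV.T4Continuum.NE9CurChartGaugeOrbit

end
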